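import Mathlib
import HarnessLib
import Literature.Analysis.FluidPDE.SelfSimilar
import Literature.Analysis.FluidPDE.TypeIAncientMild
import Summits.NavierStokesRegularity.NavierStokesRegularity.Theorems.QuarterLogPincerTruncationEdgeDefs
import Summits.NavierStokesRegularity.NavierStokesRegularity.Theorems.QuarterLogPincerQuietCollarDefs

/-!
# Route `QuarterLogPincer`, crux `TypeIQuantSubcubicExp` (stmt-NavierStokesRegularity-24077), line `quiet_collar` —
# the LOG-WEIGHTED COLLAR LEVEL: objects `QuietCollarLog`, `CutPairLog` and their closed forms

Definitions ONLY.  The v1.1 Q1-anatomy of ns-idea-7's LOOP line `quiet_collar` (objects re-homed in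
`Theorems/QuarterLogPincerQuietCollarDefs.lean`) splits the far-field truncation Q1 into QP1 `QuietCollar` (a quiet collar
`‖v s x‖ ≤ ηq` at a polynomial radius), QP2 `CutPair` (the cut pair `(V = χv(·−1), u₀)`) and QP3 `ForcedTwoNormShadowing`,
composed by the line's kernel theorem `farFieldTruncation_of_quietAnatomy`.  QP1 and QP3 are tree theorems BY NAME
(`…QuietCollarLever.stub_quietCollar`, `…QuietCollarShadowing.stub_forcedTwoNormShadowing`).

The pub-ns-dss typer's TYPED AUDIT of QP2 (cell bus 2026-08-29T00:42Z / 01:10Z, g36; 03:06Z, g37) found that the verbatim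
`CutPair` — collar level `ηq` fixed BEFORE the radius `r`, sup tolerance `η₁εⁿ` for ALL `r ≥ 2`, AND the `L³` clause
`‖u₀ − V 0‖₃ ≤ K₂(b+1)` — is not provable by the line's (Leray-projection) method: the data error `∇π[χv₀]` of a shell
source has the sharp sup size `ηq·(1 + log(r/Lq))` (hemispherical jump; tree `…QuietCollarShellPotential`), while every
r-uniform-in-sup corrector (radial transport + box lemma) violates the `L³` clause for angularly oscillating collar flux.
ONLY A LOG OF THE RADIUS is absorbable, and only on QP1's side where the radius bound `K₁ε^{-κ₁}` is explicit.  The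
repair adopted here (DIRECTOR-NS KEY-NS #187 «GO QP2 … as you propose», 2026-08-29T02:54:49Z; author ns-idea-7 g10 asked
03:06Z) changes ONE token group in each of the two objects and nothing else:

* `QuietCollarLog v` — QP1 with the delivered level `‖v s x‖ ≤ ηq / (1 + Real.log r)`; PROVED in the tree already as
  `…QuietCollar.quietCollar_log` (`Theorems/QuarterLogPincerQuietCollarLeverExplicit.lean`, p685241), so its closed form
  `StubQuietCollarLog` is discharged by name in the companion file `…QuietCollarLeverLog.lean`;
* `CutPairLog v` — QP2 with the collar HYPOTHESIS `‖v s x‖ ≤ ηq / (1 + Real.log r)`; every other clause verbatim;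
* `StubQuietCollarLog`, `StubCutPairLog` — the closed forms over `IsTypeIAncientMild M v ∧ EnvelopeCubeBudget v`.

With these two objects in place of `QuietCollar`/`CutPair` the line's composition `farFieldTruncation_of_quietAnatomy` is
byte-identical (the collar hypothesis `hquiet` is only passed from QP1's conclusion to QP2's premise), so
`StubQuietCollarLog → StubCutPairLog → StubForcedTwoNormShadowing → StubFrameBootstrap → StubQuietTruncation` holds by the
same proof; the author rebases the registered stubs at his convenience.  The v1.1 objects are untouched (append-only /
referenced-declaration rules), which is why this is a NEW module and not an edit of `…QuietCollarDefs`.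

HONEST FRAME: objects of a LOOP (calibration) line on a CAPPED crux; nothing in this file is asserted.  QP2 (in either
typing), Q2, Q3, 24077, 22144, the DSS wall W7 and Navier–Stokes regularity are OPEN / not proved.  Re-typed objects by
the pub-ns-dss typer (g37), `--supports stmt-NavierStokesRegularity-24077`.
-/

noncomputable section

-- the summit-side namespace repeats a component by design (D-0017)
set_option linter.dupNamespace false

namespace Summit.NavierStokesRegularity.NavierStokesRegularity.Cruxes.TypeIQuantSubcubicExp.QuietCollar

open MeasureTheory Set Function Metric Filter Topology
open scoped ENNReal NNReal
open Literature.Analysis Literature.Analysis.FluidPDE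
open Summit.NavierStokesRegularity.NavierStokesRegularity.Cruxes.TypeIQuantSubcubicExp.TruncationEdge (EnvelopeCubeBudget)

/-! ### The log-weighted collar level -/

/-- (QP1-log) **QUIET COLLAR WITH THE LOG-WEIGHTED LEVEL**: for any polynomial request (quietness `ηq ≥ ε^k/K`, width
`Lq ≤ K ε^{-k}`) there is, at a POLYNOMIAL radius `r + Lq ≤ K₁ ε^{-κ₁}`, a collar `{r ≤ |x| ≤ r + Lq}` on which
`|v(s,x)| ≤ ηq / (1 + log r)` for ALL `s ∈ [−1,−ε]`.  Verbatim `QuietCollar v` except for the delivered level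
(`ηq` ↦ `ηq / (1 + Real.log r)`); the log is absorbed on QP1's side because there the radius is explicitly polynomial
(`…QuietCollar.quietCollar_explicit`: `κ₁ = 16k + 18`, `K₁ = C_v K¹⁶ + 3K + 6`), see `…QuietCollar.quietCollar_log`.
[line object of `Cruxes/TypeIQuantSubcubicExp/Lines/quiet_collar.lean` (ns-idea-7), re-typed by the pub-ns-dss typer's
QP2 audit 2026-08-29 (DIRECTOR-NS KEY-NS #187)] -/
def QuietCollarLog (v : ℝ → EuclideanSpace ℝ (Fin 3) → EuclideanSpace ℝ (Fin 3)) : Prop :=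
  ∀ k K : ℝ, 0 ≤ k → 1 ≤ K → ∃ κ₁ K₁ : ℝ, 0 ≤ κ₁ ∧ 2 ≤ K₁ ∧
    ∀ ε ∈ Set.Ioc (0 : ℝ) (1 / 2), ∀ ηq Lq : ℝ, ε ^ k / K ≤ ηq → 0 < Lq → Lq ≤ K * ε ^ (-k) →
      ∃ r : ℝ, 2 ≤ r ∧ r + Lq ≤ K₁ * ε ^ (-κ₁) ∧
        ∀ s ∈ Set.Icc (-1 : ℝ) (-ε), ∀ x : EuclideanSpace ℝ (Fin 3),
          r ≤ ‖x‖ → ‖x‖ ≤ r + Lq → ‖v s x‖ ≤ ηq / (1 + Real.log r)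

/-- (QP2-log) **CUT PAIR FROM A LOG-QUIET COLLAR**: verbatim `CutPair v` except that the collar HYPOTHESIS reads
`‖v s x‖ ≤ ηq / (1 + Real.log r)` (the level delivered by `QuietCollarLog`).  With this hypothesis the Leray-projected cut
reference has data error `‖∇π[χv(−1)]‖_∞ ≤ C·(ηq/(1+log r))·(1 + log(r/Lq)) ≤ C·ηq` UNIFORMLY in `r ≥ 2` (`Lq ≥ 1`;
tree `…QuietCollar.exists_norm_gradient_divPotential_cutRef_le`), which is what the sup clauses `≤ η₁ εⁿ` for ALL `r`
require; all twelve conclusion clauses (support radius `r + Lq ≤ R ≤ K₂ε^{-k₂}r²`, smooth divergence-free compactly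
supported datum `u₀` that is `η₁εⁿ`-close to `V 0` in sup and `K₂(b+1)`-close in `L³`, the structural clauses of the
reference `V`, the mild defect `η₁εⁿ`-small in sup and `K₂(b+1)` in `L³`) are byte-identical to `CutPair`.
[line object of `Cruxes/TypeIQuantSubcubicExp/Lines/quiet_collar.lean` (ns-idea-7), re-typed by the pub-ns-dss typer's
QP2 audit 2026-08-29 (DIRECTOR-NS KEY-NS #187)] -/
def CutPairLog (v : ℝ → EuclideanSpace ℝ (Fin 3) → EuclideanSpace ℝ (Fin 3)) : Prop :=
  ∀ η₁ n : ℝ, 0 < η₁ → 0 ≤ n → ∃ k₂ K₂ : ℝ, 0 ≤ k₂ ∧ 1 ≤ K₂ ∧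
    ∀ ε ∈ Set.Ioc (0 : ℝ) (1 / 2), ∃ ηq Lq : ℝ, ε ^ k₂ / K₂ ≤ ηq ∧ 0 < Lq ∧ Lq ≤ K₂ * ε ^ (-k₂) ∧
      ∀ r : ℝ, 2 ≤ r →
        (∀ s ∈ Set.Icc (-1 : ℝ) (-ε), ∀ x : EuclideanSpace ℝ (Fin 3),
            r ≤ ‖x‖ → ‖x‖ ≤ r + Lq → ‖v s x‖ ≤ ηq / (1 + Real.log r)) →
        ∃ (R : ℝ) (V : ℝ → EuclideanSpace ℝ (Fin 3) → EuclideanSpace ℝ (Fin 3))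
          (u₀ : EuclideanSpace ℝ (Fin 3) → EuclideanSpace ℝ (Fin 3)),
          r + Lq ≤ R ∧ R ≤ K₂ * ε ^ (-k₂) * (r * r) ∧
          ContDiff ℝ (⊤ : ℕ∞) u₀ ∧ VectorCalculus.IsDivFree u₀ ∧ HasCompactSupport u₀ ∧
          (∀ x, ‖u₀ x - V 0 x‖ ≤ η₁ * ε ^ n) ∧
          ContinuousOn (uncurry V) (Set.Icc 0 (1 - ε) ×ˢ Set.univ) ∧
          (∀ t ∈ Set.Icc 0 (1 - ε), ∀ x, ‖V t x‖ ≤ ‖v (t - 1) x‖) ∧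
          (∀ t ∈ Set.Icc 0 (1 - ε), ∀ x : EuclideanSpace ℝ (Fin 3), R ≤ ‖x‖ → V t x = 0) ∧
          (∀ t ∈ Set.Icc 0 (1 - ε), ∀ x : EuclideanSpace ℝ (Fin 3), ‖x‖ ≤ r → V t x = v (t - 1) x) ∧
          (∀ t ∈ Set.Icc 0 (1 - ε), eLpNorm (V t) 3 volume ≤
              eLpNorm ((Metric.ball (0 : EuclideanSpace ℝ (Fin 3)) R).indicator (v (t - 1))) 3 volume) ∧
          (∀ t ∈ Set.Icc 0 (1 - ε), ∀ x, ‖mildDefect V t x‖ ≤ η₁ * ε ^ n) ∧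
          (∀ b : ℝ, 0 ≤ b →
            (∀ s ∈ Set.Icc (-1 : ℝ) (-ε),
                eLpNorm ((Metric.ball (0 : EuclideanSpace ℝ (Fin 3)) R).indicator (v s)) 3 volume ≤
                  ENNReal.ofReal b) →
            eLpNorm (fun x => u₀ x - V 0 x) 3 volume ≤ ENNReal.ofReal (K₂ * (b + 1)) ∧
            ∀ t ∈ Set.Icc 0 (1 - ε), eLpNorm (mildDefect V t) 3 volume ≤ ENNReal.ofReal (K₂ * (b + 1)))

/-- Registered closed form of (QP1-log): every Type-I ancient mild field with the log-shaped cube budget has a log-quiet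
collar.  Discharged by name: `…QuietCollar.stub_quietCollarLog` (`Theorems/QuarterLogPincerQuietCollarLeverLog.lean`).
[line object of `Cruxes/TypeIQuantSubcubicExp/Lines/quiet_collar.lean` (ns-idea-7), re-typed by the pub-ns-dss typer's
QP2 audit 2026-08-29 (DIRECTOR-NS KEY-NS #187)] -/
def StubQuietCollarLog : Prop :=
  ∀ (M : ℝ) (v : ℝ → EuclideanSpace ℝ (Fin 3) → EuclideanSpace ℝ (Fin 3)),
    IsTypeIAncientMild M v → EnvelopeCubeBudget v → QuietCollarLog v

/-- Registered closed form of (QP2-log) — THE OPEN PIECE of the line's edge Q1 in the log-weighted typing.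
[line object of `Cruxes/TypeIQuantSubcubicExp/Lines/quiet_collar.lean` (ns-idea-7), re-typed by the pub-ns-dss typer's
QP2 audit 2026-08-29 (DIRECTOR-NS KEY-NS #187)] -/
def StubCutPairLog : Prop :=
  ∀ (M : ℝ) (v : ℝ → EuclideanSpace ℝ (Fin 3) → EuclideanSpace ℝ (Fin 3)),
    IsTypeIAncientMild M v → EnvelopeCubeBudget v → CutPairLog v

end Summit.NavierStokesRegularity.NavierStokesRegularity.Cruxes.TypeIQuantSubcubicExp.QuietCollar

end
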